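import Summits.ABC.IUTFork.Cor312SettingReal
import Mathlib.Analysis.RCLike.Basic
import HarnessLib

/-!
# [IUTchIII] Corollary 3.12, statement — hull frames at ARCHIMEDEAN packets; settings with per-place frames

Record-only file (D-0012) of the abc-iut cell (Cor. 3.12 crew, wave 2, seat abc-iut-c312-7; claim W2-B); TAKES NO
SIDE. `Cor312HullFrameReal` builds the REAL hull frame `HullFrame.ofLocalFields K` of a finite direct sum of
NONARCHIMEDEAN local fields (the frame axiom = campaign-S's `isHullSet_holomorphicHull`, which uses the
ultrametric attainment of the radii), and `Cor312SettingReal` assembles a `Cor312.Setting` from `RealPieces`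
whose every packet is of that kind. But the tensor packets of [IUTchIII] Prop. 3.1/3.2 at the ARCHIMEDEAN place
`v_ℚ ∈ 𝕍_ℚ^arc` are direct sums of copies of `ℂ` (Prop. 3.2 (ii), p. 99: integral structures = closed unit balls of
the tensor-product Hermitian metric; Rmk. 3.9.5 (i): hull-sets `λ·𝒪` relative to "the direct sum decomposition
as a direct sum of fields" — at complex archimedean fields `𝒪` = the closed unit disc), which are not ultrametric.
This file supplies the archimedean half and the per-place assembler:

* `HullFrame.NormSurjective K` ("every nonnegative real is a norm in each `K_j`" — true for `ℝ`, `ℂ`: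
  `normSurjective_of_rclike`) and, under it, S2's hull IS the smallest hull-set for bounded nondegenerate `U`
  WITHOUT ultrametricity (`isHullSet_holomorphicHull_of_normSurjective`, `holomorphicHull_eq_sInter_of_normSurjective`:
  take `λ_j` of norm `sup_{u∈U} ‖u_j‖ > 0`) — whence the REAL archimedean frame `HullFrame.ofNormSurjective` and
  `ofNormSurjective_hull_eq` (= S2 `holomorphicHull`);
* `Setting.RealFrames` / `Setting.ofFrames` — the assembler of `Cor312SettingReal` with the hull frame of each
  real packet supplied PER `(j, v_ℚ)` (nonarchimedean: `ofLocalFields`; archimedean: `ofNormSurjective`), subject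
  to `hul_iff : H ∈ (frameK j vQ).Hul ↔ IsHullSet (K j vQ) H` so that the q-pilot image `e⁻¹'(λ_q·𝒪_L)` is still a
  hull-set by THEOREM (`ofFrames_qRegion_mem_hul`), and `HullDefined` is read on the real packet
  (`ofFrames_hullDefined_iff`).
[claim: Mochizuki2012, status: disputed] for the quoted definitions; the constructions are bookkeeping. Deliberately
NOT here: the Hermitian-metric unit balls themselves (S2/L5-t7 `ArchimedeanTensorCopies`, L4-t3
`LocalVolumesArchimedean`), log-volumes, any judgement.
-/

noncomputable section

namespace Summit.ABC.IUTFork.Cor312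

open Thm311 Literature.IUT.LogThetaLattice

namespace HullFrame

open Literature.IUT.LogVolume

variable {J : Type} [Fintype J] (K : J → Type) [∀ j, NontriviallyNormedField (K j)]

/-- "Every nonnegative real number is the norm of some element of `K_j`", for every factor — the property
of `ℝ` and `ℂ` that replaces ultrametric attainment of the radii at archimedean packets. [folklore] -/
def NormSurjective : Prop := ∀ (j : J) (r : ℝ), 0 ≤ r → ∃ x : K j, ‖x‖ = r

omit [Fintype J] in
/-- `ℝ`, `ℂ` (any `RCLike` field) are norm-surjective: `‖(r : 𝕜)‖ = r` for `r ≥ 0`. [folklore] -/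
theorem normSurjective_of_rclike (𝕜 : Type) [RCLike 𝕜] (J : Type) :
    NormSurjective (fun _ : J => 𝕜) := fun _ r hr =>
  ⟨(r : 𝕜), by rw [RCLike.norm_ofReal, abs_of_nonneg hr]⟩

/-- The radii of a bounded NONDEGENERATE set are positive. [folklore] -/
theorem hullRadius_pos_of_isNondegenerate {U : Set (Π j, K j)} (hU : Bornology.IsBounded U)
    (hnd : IsNondegenerate K U) (j : J) : 0 < hullRadius K U j := by
  obtain ⟨u, hu, hne⟩ := hnd j
  exact (norm_pos_iff.mpr hne).trans_le (norm_apply_le_hullRadius K hU hu j)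

/-- **Existence of the hull at archimedean packets** ([IUTchIII] Rmk. 3.9.5 (i), p. 127: "the smallest subset of
the form `λ·𝒪_{(−)}` … that contains `U`"): for norm-surjective factors, the hull of a bounded nondegenerate `U` IS a
hull-set — take `λ_j` of norm `sup_{u ∈ U} ‖u_j‖ (> 0)`. PROVED (no ultrametricity). [claim: Mochizuki2012, status: disputed] -/
theorem isHullSet_holomorphicHull_of_normSurjective (hK : NormSurjective K) {U : Set (Π j, K j)}
    (hU : Bornology.IsBounded U) (hnd : IsNondegenerate K U) : IsHullSet K (holomorphicHull K U) := by
  choose c hc using fun j => hK j (hullRadius K U j) (hullRadius_nonneg K U j)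
  refine ⟨c, fun j => norm_pos_iff.mp ((hc j).symm ▸ hullRadius_pos_of_isNondegenerate K hU hnd j), ?_⟩
  rw [holomorphicHull_of_isBounded K hU]
  unfold hullSet
  congr 1
  funext j
  exact (hc j).symm

/-- `φ(U) = ⋂_{Hul ∋ H ⊇ U} H` at archimedean packets (Rmk. 3.9.5 (ii), p. 127). PROVED. [claim: Mochizuki2012, status: disputed] -/
theorem holomorphicHull_eq_sInter_of_normSurjective (hK : NormSurjective K) {U : Set (Π j, K j)}
    (hU : Bornology.IsBounded U) (hnd : IsNondegenerate K U) :
    holomorphicHull K U = ⋂₀ {H : Set (Π j, K j) | IsHullSet K H ∧ U ⊆ H} :=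
  le_antisymm (Set.subset_sInter fun _ hH => holomorphicHull_subset_of_isHullSet K hH.1 hH.2)
    (Set.sInter_subset_of_mem ⟨isHullSet_holomorphicHull_of_normSurjective K hK hU hnd, subset_holomorphicHull K U⟩)

/-- **The REAL hull frame at an archimedean packet** `⊕_j K_j`, `K_j` norm-surjective (e.g. `ℂ`): hull-sets `λ·𝒪_L`
(`IsHullSet`, `𝒪` = product of closed unit balls), bounded = `Bornology.IsBounded`, admits a hull = `IsNondegenerate`;
`hull_mem` = `isHullSet_holomorphicHull_of_normSurjective`. [claim: Mochizuki2012, status: disputed] -/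
def ofNormSurjective (hK : NormSurjective K) : HullFrame (Π j, K j) where
  Hul := {H | IsHullSet K H}
  IsBounded := Bornology.IsBounded
  HasHull := IsNondegenerate K
  hul_bounded H h := IsHullSet.isBounded K h
  bounded_mono U U' h hb := hb.subset h
  exists_hul U hb := by
    obtain ⟨H, hH, hUH⟩ := exists_isHullSet_superset K hb
    exact ⟨H, hH, hUH⟩
  hull_mem U hb hnd := by
    have : ⋂₀ {H | H ∈ {H : Set (Π j, K j) | IsHullSet K H} ∧ U ⊆ H} = holomorphicHull K U := by
      rw [holomorphicHull_eq_sInter_of_normSurjective K hK hb hnd]; rfl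
    rw [this]
    exact isHullSet_holomorphicHull_of_normSurjective K hK hb hnd

/-- On bounded nondegenerate `U` the archimedean frame's hull IS S2's `holomorphicHull`. [folklore] -/
theorem ofNormSurjective_hull_eq (hK : NormSurjective K) {U : Set (Π j, K j)} (hb : Bornology.IsBounded U)
    (hnd : IsNondegenerate K U) : (ofNormSurjective K hK).hull U = holomorphicHull K U := by
  unfold hull
  rw [if_pos (show (ofNormSurjective K hK).IsBounded U from hb),
    holomorphicHull_eq_sInter_of_normSurjective K hK hb hnd]
  rfl

/-- The archimedean frame's hull-sets are exactly S2's hull sets. [folklore] -/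
theorem mem_ofNormSurjective_hul (hK : NormSurjective K) {H : Set (Π j, K j)} :
    H ∈ (ofNormSurjective K hK).Hul ↔ IsHullSet K H := Iff.rfl

end HullFrame

/-! ## Settings with the real frame supplied per `(j, v_ℚ)` -/

namespace Setting

variable {T : ThetaIndex} (S : Situation T)

/-- Real-packet pieces with the HULL FRAME GIVEN PER PACKET: as `RealPieces` (summand fields `K j v_ℚ i`,
comparison maps `e`, Θ-boxes, q-centre) but without the ultrametric/properness instances; instead a frame
`frameK j vQ` on each real packet whose hull-sets are exactly S2's `IsHullSet` (nonarchimedean `v_ℚ`: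
`HullFrame.ofLocalFields`; archimedean: `HullFrame.ofNormSurjective`). [claim: Mochizuki2012, status: disputed] -/
structure RealFrames (ObLgp ObΔ : Type) : Type 1 where
  /-- summand index of the completed packet at `(j, v_ℚ)` -/
  J : T.Label → T.VQ → Type
  /-- … is finite -/
  [instFintype : ∀ j vQ, Fintype (J j vQ)]
  /-- the summand fields -/
  K : ∀ j vQ, J j vQ → Type
  /-- … are nontrivially normed fields -/
  [instField : ∀ j vQ i, NontriviallyNormedField (K j vQ i)]
  /-- the comparison map packet → ⊕ of fields ([IUTchIII] Prop. 3.1 (i), 3.2 (i)) -/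
  e : ∀ j vQ, S.L.Packet j vQ → ∀ i, K j vQ i
  /-- the real hull frame of each packet -/
  frameK : ∀ j vQ, HullFrame (∀ i, K j vQ i)
  /-- … whose hull-sets are S2's `λ·𝒪_L` -/
  hul_iff : ∀ j vQ (H : Set (∀ i, K j vQ i)),
    H ∈ (frameK j vQ).Hul ↔ Literature.IUT.LogVolume.IsHullSet (K j vQ) H
  /-- the Θ-pilot region of the real packet at lattice position `(n, m)` -/
  thetaBox : ℤ → ObLgp → ∀ j vQ, Set (∀ i, K j vQ i)
  /-- the centre `λ_q` of the q-pilot hull-set -/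
  qCentre : ObΔ → ∀ j vQ, ∀ i, K j vQ i

attribute [instance] RealFrames.instFintype RealFrames.instField

variable {S}

/-- **Assembling a setting from per-packet real frames** (the `RealFrames` analogue of `ofComparison`): frames
pulled back along `e`, q-image = preimage of `λ_q·𝒪_L` (a hull-set by `hul_iff`), Θ-images = preimages of the
boxes. [claim: Mochizuki2012, status: disputed] -/
def ofFrames (n : ℤ) {HT : Type} {LogLink : HT → HT → Type} {IsFull : ∀ {s t : HT}, LogLink s t → Prop}
    (lat : LGPGaussianLogThetaLattice LogLink IsFull)
    {Frd : Type} {IsoF : Frd → Frd → Type} {Ob : Frd → Type} {realify : Frd → Frd} {Strip : Type}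
    {IsoS : Strip → Strip → Type} {M : ∀ v : T.V, v ∈ T.Vbad → Type} [∀ v h, Monoid (M v h)]
    (sig : GlobalLGPFrobenioidSignature T.lstar T.V (· ∈ T.Vbad) Frd IsoF Ob realify Strip IsoS M)
    (split : SplittingMonoids M) {ObΔ : Type} {N : ∀ v : T.V, v ∈ T.Vbad → Type} [∀ v h, Monoid (N v h)]
    (qData : QPilotData ObΔ N) (R : RealFrames S (Ob sig.Clgp) ObΔ)
    (hq : ∀ j vQ i, R.qCentre (qPilotObject qData) j vQ i ≠ 0)
    (hadm : ∀ j vQ (H : Set (∀ i, R.K j vQ i)), Literature.IUT.LogVolume.IsHullSet (R.K j vQ) H →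
      (S.D n).Adm j vQ (R.e j vQ ⁻¹' H))
    (hfin : ∀ j : T.Label, (Function.support fun vQ => (S.D n).logvol j vQ
      (R.e j vQ ⁻¹' Literature.IUT.LogVolume.hullSet (R.K j vQ) (R.qCentre (qPilotObject qData) j vQ))).Finite) :
    Setting S where
  n := n
  HT := HT
  LogLink := LogLink
  IsFull := IsFull
  lattice := lat
  Frd := Frd
  IsoF := IsoF
  Ob := Ob
  realify := realify
  Strip := Strip
  IsoS := IsoS
  M := M
  sig := sig
  split := split
  ObΔ := ObΔ
  N := N
  qData := qData
  frame j vQ := (R.frameK j vQ).comap (R.e j vQ)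
  hul_adm j vQ H hH := by
    obtain ⟨H', hH', rfl⟩ := hH
    exact hadm j vQ H' ((R.hul_iff j vQ H').mp hH')
  thetaRegionOf m o j vQ := R.e j vQ ⁻¹' R.thetaBox m o j vQ
  qRegionOf o j vQ := R.e j vQ ⁻¹' Literature.IUT.LogVolume.hullSet (R.K j vQ) (R.qCentre o j vQ)
  qRegion_mem j vQ :=
    ⟨_, (R.hul_iff j vQ _).mpr ⟨R.qCentre (qPilotObject qData) j vQ, hq j vQ, rfl⟩, rfl⟩
  qSupport_finite := hfin

section

variable (n : ℤ) {HT : Type} {LogLink : HT → HT → Type} {IsFull : ∀ {s t : HT}, LogLink s t → Prop}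
  (lat : LGPGaussianLogThetaLattice LogLink IsFull)
  {Frd : Type} {IsoF : Frd → Frd → Type} {Ob : Frd → Type} {realify : Frd → Frd} {Strip : Type}
  {IsoS : Strip → Strip → Type} {M : ∀ v : T.V, v ∈ T.Vbad → Type} [∀ v h, Monoid (M v h)]
  (sig : GlobalLGPFrobenioidSignature T.lstar T.V (· ∈ T.Vbad) Frd IsoF Ob realify Strip IsoS M)
  (split : SplittingMonoids M) {ObΔ : Type} {N : ∀ v : T.V, v ∈ T.Vbad → Type} [∀ v h, Monoid (N v h)]
  (qData : QPilotData ObΔ N) (R : RealFrames S (Ob sig.Clgp) ObΔ)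
  (hq : ∀ j vQ i, R.qCentre (qPilotObject qData) j vQ i ≠ 0)
  (hadm : ∀ j vQ (H : Set (∀ i, R.K j vQ i)), Literature.IUT.LogVolume.IsHullSet (R.K j vQ) H →
    (S.D n).Adm j vQ (R.e j vQ ⁻¹' H))
  (hfin : ∀ j : T.Label, (Function.support fun vQ => (S.D n).logvol j vQ
    (R.e j vQ ⁻¹' Literature.IUT.LogVolume.hullSet (R.K j vQ) (R.qCentre (qPilotObject qData) j vQ))).Finite)

/-- In the per-frame assembly the q-pilot image is a hull-set of the (pulled-back) frame — PROVED. [folklore] -/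
theorem ofFrames_qRegion_mem_hul (j : T.Label) (vQ : T.VQ) :
    (ofFrames n lat sig split qData R hq hadm hfin).qRegion j vQ ∈
      ((ofFrames n lat sig split qData R hq hadm hfin).frame j vQ).Hul :=
  (ofFrames n lat sig split qData R hq hadm hfin).qRegion_mem j vQ

/-- In the per-frame assembly `HullDefined` is read on the real packet through the given frame:
bounded image and an image admitting a hull. [folklore] -/
theorem ofFrames_hullDefined_iff (j : T.Label) (vQ : T.VQ) :
    (ofFrames n lat sig split qData R hq hadm hfin).HullDefined j vQ ↔
      (R.frameK j vQ).IsBounded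
          (R.e j vQ '' ⋃₀ (ofFrames n lat sig split qData R hq hadm hfin).possibleImages j vQ) ∧
        (R.frameK j vQ).HasHull
          (R.e j vQ '' ⋃₀ (ofFrames n lat sig split qData R hq hadm hfin).possibleImages j vQ) :=
  Iff.rfl

end

end Setting

end Summit.ABC.IUTFork.Cor312

end
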